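import Summits.BirchSwinnertonDyer.BirchSwinnertonDyer.Theses.ByReductionTypeAtTwo
import Summits.BirchSwinnertonDyer.Rank1Residual.F1Sign2.DescentSignAtTwo
import Literature.NumberTheory.EllipticCurves.PAdicHeights
import Literature.NumberTheory.EllipticCurves.BSDRootNumberSmallConductorProofs
import Literature.NumberTheory.EllipticCurves.GlobalMinimalModel
import HarnessLib

/-!
# ES-29 (cell bsd-f1-sign2, seat -es g20): THE SECOND RECIPROCITY LAW OF MOD-2 LEVEL RAISING — THE SIGN OF THE LEVEL-RAISED CURVE

Sketch only (planner seat; nothing here is proposed to the tree; the typer ports).  Crux `RankOneAtTwoBigImageOddLocal`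
(stmt-BirchSwinnertonDyer-23715).  Continuation of ES-28 (g19, `Sketch28.lean`: level-raising Euler system at `p = 2` over `ℚ` at a
TRANSPOSITION prime `q`, `(Δ_W/q) = −1`, `W'` of conductor `N_W q` with `W'[2] ≅ W[2]`).

MECHANISM (the «signed object at 2» of this lens).  Write `ρ_{W',4} = (1 + 2c)·ρ_{W,4}` with `c ∈ Z¹(ℚ, End W[2])`.  As an `S₃`-module
`End W[2] = 𝔽₂[S₃/A₃] ⊕ W[2]`, so `[c] = (ψ, ξ) ∈ H¹(F, 𝔽₂) ⊕ H¹(ℚ, W[2])`, `F = ℚ(√Δ_W)`; `tr c = 0` forces `ψ = res_F χ_{d'}` (`d' ∈ ℚˣ`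
mod `⟨Δ_W, ℚˣ²⟩`: «`W'[4]` is `W^{(d')}[4]` up to the `W[2]`-part»), and — THEOREM of the memo (MEMO-es §29 (T3)) — the `W[2]`-part is the
product of differents `ξ = β(W,W') = f'_W(θ)·f'_{W'}(θ') = γ_W + γ_{W'}` in `ker(N : K₃ˣ/K₃ˣ² → ℚˣ/ℚˣ²) = H¹(ℚ, W[2])`, where
`γ_W := −Δ_W·f'_W(θ)` is the class cutting out the `S₄`-field inside `ℚ(W[4])`.  Hilbert reciprocity for `(d', −Δ_W)` over `ℚ` and for
`(β, γ_W)` in the cubic field `K₃`, with the local dictionary at `q`, at the multiplicative `p ∣ N_W`, and at `∞`, gives the LAW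

  `#{p ∣ N_W : w_p(W') ≠ w_p(W)} ≡ t_q(W')·n_q(W) + κ_∞(W,W') + C₂ (mod 2)`,

`t_q = [v_q(Δ_{W'}) ≡ 2 (4)]` (`W'[4]` ramified at `q`), `n_q(W) = [4 ∤ #W̃(𝔽_q)]` (`= [a_q(W) ≢ q+1 (mod 4)]`: Ribet's congruence
`a_q ≡ ε_q (q+1)` read MOD 4), `κ_∞ = [σ moves both the smallest and the largest real 2-division abscissa]` (`σ` the root bijection of the
congruence; `0` if `Δ_W < 0`), and `C₂` a `2`-adic symbol which VANISHES on the frame `4 ∤ N_W`, `ρ̄|_{G_{ℚ₂}} ≠ 1` (conjecture ES-29B; for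
`2 ∥ N_W` half of it is automatic).  Equivalently (root numbers: `w(W') = −w(W)·ε_q·(−1)^{#flips}`):  THE SIGN OF THE LEVEL-RAISED CURVE IS
`w(W') = −w(W) · ε_q · (ε*_q)^{t_q} · (−1)^{κ_∞}`,  `ε*_q := +1` if `4 ∣ #W̃(𝔽_q)` else `−1`.
Census (BC5 witness): ENGINE LR28 rows (g19, kit j329192+j329376, sha16 4d420fce83dfd191) analysed by `analyse29_offline.py` 152a25a4aa8d925a:
91 167 / 91 167 frame rows (`r_an(W) = 1`; `ε_q = −1`: 45 110, `+1`: 46 057; `2 ∤ N`: 21 748, `2 ∥ N`: 69 419; `Δ<0`: 37 479, `Δ>0`: 53 688),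
0 violations; all 12 admissible cells of the 5-bit table `(sgn Δ, t, n, κ, #flips mod 2)` populated, all inadmissible cells empty; OFF the frame
(`4 ∣ N_W`) `C₂ = 1` on 59 560 / 123 979 rows (so the frame hypothesis is load-bearing), constant on fine Kodaira cells at `2`.
-/

noncomputable section

open scoped Classical

set_option linter.dupNamespace false
set_option autoImplicit false

namespace Summit.BirchSwinnertonDyer.BirchSwinnertonDyer.Theorems.RankOneAtTwoSignReciprocity

open Literature.NumberTheory.EllipticCurves Summit.BirchSwinnertonDyer.Rank1Residual.F1Sign2 WeierstrassCurve

/-- The `2`-division cubic `4x³ + b₂x² + 2b₄x + b₆` of `W` (Mathlib `twoTorsionPolynomial`). -/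
abbrev twoDivCubic (W : WeierstrassCurve ℚ) : Polynomial ℚ := W.twoTorsionPolynomial.toPoly

/-- **`W ≡ W' (mod 2)`**: the cubic stem algebras `ℚ[x]/(f_W) ≅ ℚ[x]/(f_{W'})`; for `ρ̄_{W,2}` onto `S₃` this is `W[2] ≅ W'[2]`, and the
isomorphism is unique (ES-28, g19). -/
def ModTwoCongruent (W W' : WeierstrassCurve ℚ) : Prop :=
  Nonempty (AdjoinRoot (twoDivCubic W) ≃ₐ[ℚ] AdjoinRoot (twoDivCubic W'))

/-- `x` is the smallest real root of `f`. -/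
def IsMinRealRoot (f : Polynomial ℚ) (x : ℝ) : Prop :=
  Polynomial.aeval x f = 0 ∧ ∀ y : ℝ, Polynomial.aeval y f = 0 → x ≤ y

/-- `x` is the largest real root of `f`. -/
def IsMaxRealRoot (f : Polynomial ℚ) (x : ℝ) : Prop :=
  Polynomial.aeval x f = 0 ∧ ∀ y : ℝ, Polynomial.aeval y f = 0 → y ≤ x

/-- **`σ(e_min) = e'_min`**: the congruence sends the smallest real `2`-division abscissa of `W` to that of `W'` (`= L_∞(W) = L_∞(W')`,
ES-28 `SameRealKummerLine`; automatic when `Δ_W < 0`). -/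
def SendsMinToMin (W W' : WeierstrassCurve ℚ) : Prop :=
  ∃ σ : AdjoinRoot (twoDivCubic W) ≃ₐ[ℚ] AdjoinRoot (twoDivCubic W'),
    ∀ ι : AdjoinRoot (twoDivCubic W') →ₐ[ℚ] ℝ,
      IsMinRealRoot (twoDivCubic W) (ι (σ (AdjoinRoot.root (twoDivCubic W)))) ↔
        IsMinRealRoot (twoDivCubic W') (ι (AdjoinRoot.root (twoDivCubic W')))

/-- **`σ(e_max) = e'_max`**: the congruence sends the largest real `2`-division abscissa of `W` to that of `W'` (automatic when `Δ_W < 0`). -/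
def SendsMaxToMax (W W' : WeierstrassCurve ℚ) : Prop :=
  ∃ σ : AdjoinRoot (twoDivCubic W) ≃ₐ[ℚ] AdjoinRoot (twoDivCubic W'),
    ∀ ι : AdjoinRoot (twoDivCubic W') →ₐ[ℚ] ℝ,
      IsMaxRealRoot (twoDivCubic W) (ι (σ (AdjoinRoot.root (twoDivCubic W)))) ↔
        IsMaxRealRoot (twoDivCubic W') (ι (AdjoinRoot.root (twoDivCubic W')))

/-- **`κ_∞(W,W') = 0` — the archimedean twist of the congruence is EVEN**: the root bijection `σ` fixes the smallest OR the largest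
abscissa, i.e. `σ ∈ {id, (min mid), (mid max)}`; it is ODD (`κ_∞ = 1`) for `σ ∈ {(min max), 3-cycles}`.  Cohomologically
`κ_∞ = ⟨β, γ_W⟩_∞ + ψ_∞ = [σ(e_mid) ≠ e'_mid] + [σ an odd permutation]` (MEMO-es §29 (T4)).  Always even when `Δ_W < 0`. -/
def RealTwistEven (W W' : WeierstrassCurve ℚ) : Prop := SendsMinToMin W W' ∨ SendsMaxToMax W W'

/-- **`n_q(W) = 0` — the `𝔽_q`-rational `2`-torsion point is halvable**: `4 ∣ #W̃(𝔽_q)` (at a transposition prime `W̃(𝔽_q)[2] ≅ ℤ/2`, so this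
is `T ∈ 2W̃(𝔽_q)`, `⇔ f'_W(θ_q) ∈ 𝔽_qˣ²`, `⇔ a_q(W) ≡ q + 1 (mod 4)`: Ribet's level-raising congruence `a_q ≡ ε(q+1) (mod 2)` READ MOD 4 with
the sign `ε*_q = +1`).  `W.reductionPointCount q = #W̃(𝔽_q)` for `W` globally minimal with good reduction at `q`. -/
def TwoTorsionHalvableModQ (W : WeierstrassCurve ℚ) [W.IsGloballyMinimal] (q : ℕ) : Prop := 4 ∣ W.reductionPointCount q

/-- **`t_q(W') = 1` — `W'[4]` is RAMIFIED at the multiplicative prime `q`**: `v_q(Δ_{W'}) ≡ 2 (mod 4)` (it is even since `W'[2]` is unramified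
at `q`; `W'` globally minimal).  (ES-28 `MonodromyBitAtTwo`.) -/
def MonodromyBitAtTwo (W' : WeierstrassCurve ℚ) (q : ℕ) : Prop := ¬ (4 : ℤ) ∣ padicValRat q W'.Δ

/-- `ρ̄_{W,2}|_{G_{ℚ₂}} ≠ 1`: the `2`-division cubic does not split completely over `ℚ₂` (Le Hung–Li 2016, Assumption 7 (4)). -/
def NontrivialAtTwo (W : WeierstrassCurve ℚ) : Prop :=
  ((twoDivCubic W).map (algebraMap ℚ ℚ_[2])).roots.card < 3

/-- **The predicted sign factor of mod-`2` level raising at a transposition prime**: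
`s(W,W',q) = ε_q · (ε*_q)^{t_q} · (−1)^{κ_∞}` with `ε_q = ±1` the split/non-split sign of `W'` at `q`, `ε*_q = −1` iff `4 ∤ #W̃(𝔽_q)`,
`t_q = [v_q(Δ_{W'}) ≡ 2 (4)]`, `κ_∞` the archimedean twist.  The law says `w(W') = −w(W)·s(W,W',q)`. -/
def levelRaisedSignFactor (W W' : WeierstrassCurve ℚ) [W.IsGloballyMinimal] (q : ℕ) [Fact q.Prime] : ℤ :=
  (if W'.HasSplitMultiplicativeReductionAtPrime q then 1 else -1) *
    (if MonodromyBitAtTwo W' q ∧ ¬ TwoTorsionHalvableModQ W q then -1 else 1) *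
    (if RealTwistEven W W' then 1 else -1)

/-- **ES-29A `LevelRaisedSignLawAtTwo` — THE SECOND RECIPROCITY LAW OF MOD-2 LEVEL RAISING: THE ROOT NUMBER OF THE LEVEL-RAISED CURVE
(CONJECTURE-candidate of this lens = «law + `C₂ = 0` on the frame»; the law with an unspecified `2`-adic symbol `C₂(W,W')` is a theorem
sketch, MEMO-es §29 (T1)–(T5)).**  FRAME: `W` of the slice (non-CM, `ρ_{W,2^n}` onto for all `n`, odd torsion, odd Tamagawa product — so every
multiplicative `p ∣ N_W` has `v_p(Δ_W)` odd), `4 ∤ N_W`, `ρ̄|_{G_{ℚ₂}} ≠ 1`; `q ∤ 2N_W` prime with `(Δ_W/q) = −1`; `W'` globally minimal of conductor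
`N_W q`, congruent to `W` mod `2`, multiplicative at `q` of EITHER sign.  THEN, writing root numbers as parities of analytic ranks
(`w = (−1)^{r_an}`):   `w(W')·w(W) = −ε_q·(ε*_q)^{t_q}·(−1)^{κ_∞}`,  i.e.
`r_an(W') ≡ r_an(W) (mod 2)  ⟺  levelRaisedSignFactor W W' q = −1`.
In words: raising the level mod `2` at `q` flips an ODD number of local signs at `p ∣ N_W` exactly when [`W'[4]` ramifies at `q` AND Ribet's
congruence `a_q(W) ≡ ε(q+1)` fails mod `4` for `ε = +1`] XOR [the congruence moves both extreme real `2`-division abscissae].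
Why it might fail: the `2`-adic symbol `C₂ = r₂(ψ) + ⟨β,γ_W⟩₂` might not vanish on some `2`-adic class inside the frame not met by the census
(all `(v₂N, Kodaira(W), Kodaira(W'))` cells met so far are clean, incl. differing Kodaira types at `2 ∥ N`); at an ADDITIVE odd `p ∣ N_W` the local
dictionary is unproved (census-clean); the census has `r_an(W) = 1` only (`w(W) = −1`; the `w(W) = +1` base is untested but the mechanism is
symmetric).  OFF the frame the statement is FALSE as typed (`4 ∣ N_W`: 59 560 / 123 979 counterexamples; `ρ̄|_{G_{ℚ₂}} = 1`: 1 523 / 2 820).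
Census: module docstring.  [cite: Ribet1990ICM, Thm. 1 (level raising: a_q ≡ ±(q+1) mod ℓ)] [cite: DiamondTaylor1994, Thm. A]
[cite: LeHungLi2016, Thm. 15, Lemma 44–45 (mod-2 level raising with signs; the lines at a transposition prime)]
[cite: Cassels1998JRAM, §2 (H¹(ℚ,E[2]) ⊂ K₃ˣ/K₃ˣ²; local pairing = sum of Hilbert symbols over w ∣ v)] [cite: PoonenRains2012, Thm. 4.14, Prop. 2.6 (self-cup-product
= connecting map of the theta characteristic / Heisenberg extension)] [cite: DokchitserDokchitserAnnals2010, Thm. 1.4 (2-parity)] -/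
@[conjecture] def LevelRaisedSignLawAtTwo : Prop :=
  ∀ (W W' : WeierstrassCurve ℚ) [W.IsElliptic] [W.IsGloballyMinimal] [W'.IsElliptic] [W'.IsGloballyMinimal]
    (q : ℕ) [Fact q.Prime],
    ¬ W.HasCM → (∀ n : ℕ, W.HasSurjectiveModNGaloisRep ((2 ^ n : ℕ) : ℤ)) → Odd W.torsionOrder → Odd W.tamagawaProduct →
    ¬ (4 : ℕ) ∣ W.conductorNorm ℤ → NontrivialAtTwo W →
    q ≠ 2 → ¬ (q : ℤ) ∣ (W.conductorNorm ℤ : ℤ) → jacobiSym W.Δ.num q = -1 → W'.conductorNorm ℤ = q * W.conductorNorm ℤ →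
    ModTwoCongruent W W' → W'.HasMultiplicativeReductionAtPrime q →
      ((Even W'.analyticRank ↔ Even W.analyticRank) ↔ levelRaisedSignFactor W W' q = -1)

/-- **ES-29N `LevelRaisedSignLawAtTwoNeg` — the `Δ_W < 0` shadow** (no archimedean twist): `r_an(W') ≡ r_an(W) (mod 2)` iff
[`W'` split at `q` ⟺ (`v_q(Δ_{W'}) ≡ 2 (4)` ∧ `4 ∤ #W̃(𝔽_q)`)].  In particular (`t_q = 0`): if `4 ∣ v_q(Δ_{W'})` then the level-raised curve has
the parity of `W` iff it is NON-split at `q` — mod-`2` level raising with `4`-unramified `W'[4]` never flips an odd number of signs at `p ∣ N_W`.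
Frame rows with `Δ_W < 0`: 37 479 / 37 479.  Same sources as ES-29A. -/
@[conjecture] def LevelRaisedSignLawAtTwoNeg : Prop :=
  ∀ (W W' : WeierstrassCurve ℚ) [W.IsElliptic] [W.IsGloballyMinimal] [W'.IsElliptic] [W'.IsGloballyMinimal]
    (q : ℕ) [Fact q.Prime],
    ¬ W.HasCM → (∀ n : ℕ, W.HasSurjectiveModNGaloisRep ((2 ^ n : ℕ) : ℤ)) → Odd W.torsionOrder → Odd W.tamagawaProduct →
    ¬ (4 : ℕ) ∣ W.conductorNorm ℤ → NontrivialAtTwo W →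
    q ≠ 2 → ¬ (q : ℤ) ∣ (W.conductorNorm ℤ : ℤ) → jacobiSym W.Δ.num q = -1 → W'.conductorNorm ℤ = q * W.conductorNorm ℤ →
    ModTwoCongruent W W' → W'.HasMultiplicativeReductionAtPrime q → W.Δ < 0 →
      ((Even W'.analyticRank ↔ Even W.analyticRank) ↔
        (W'.HasSplitMultiplicativeReductionAtPrime q ↔ (MonodromyBitAtTwo W' q ∧ ¬ TwoTorsionHalvableModQ W q)))

/-- **ES-29U `LevelRaisedSignLawAtTwoUnram` — the `4`-unramified shadow** (`t_q = 0`, no dependence on `a_q mod 4`): if `4 ∣ v_q(Δ_{W'})` then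
`w(W')·w(W) = −ε_q·(−1)^{κ_∞}`.  Frame rows with `t_q = 0`: 29 671 / 29 671. -/
@[conjecture] def LevelRaisedSignLawAtTwoUnram : Prop :=
  ∀ (W W' : WeierstrassCurve ℚ) [W.IsElliptic] [W.IsGloballyMinimal] [W'.IsElliptic] [W'.IsGloballyMinimal]
    (q : ℕ) [Fact q.Prime],
    ¬ W.HasCM → (∀ n : ℕ, W.HasSurjectiveModNGaloisRep ((2 ^ n : ℕ) : ℤ)) → Odd W.torsionOrder → Odd W.tamagawaProduct →
    ¬ (4 : ℕ) ∣ W.conductorNorm ℤ → NontrivialAtTwo W →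
    q ≠ 2 → ¬ (q : ℤ) ∣ (W.conductorNorm ℤ : ℤ) → jacobiSym W.Δ.num q = -1 → W'.conductorNorm ℤ = q * W.conductorNorm ℤ →
    ModTwoCongruent W W' → W'.HasMultiplicativeReductionAtPrime q → (4 : ℤ) ∣ padicValRat q W'.Δ →
      ((Even W'.analyticRank ↔ Even W.analyticRank) ↔ (W'.HasSplitMultiplicativeReductionAtPrime q ↔ ¬ RealTwistEven W W'))

/-- Sign algebra: with an even archimedean twist the factor is `−1` iff `ε_q = (ε*_q)^{t_q}·(−1)`… i.e. split `⇔ (t_q ∧ n_q)`. -/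
theorem signFactor_eq_neg_one_iff_of_realTwistEven (W W' : WeierstrassCurve ℚ) [W.IsGloballyMinimal] (q : ℕ) [Fact q.Prime]
    (hκ : RealTwistEven W W') :
    levelRaisedSignFactor W W' q = -1 ↔
      (W'.HasSplitMultiplicativeReductionAtPrime q ↔ (MonodromyBitAtTwo W' q ∧ ¬ TwoTorsionHalvableModQ W q)) := by
  unfold levelRaisedSignFactor
  by_cases hs : W'.HasSplitMultiplicativeReductionAtPrime q <;>
    by_cases ht : (MonodromyBitAtTwo W' q ∧ ¬ TwoTorsionHalvableModQ W q) <;> simp [hs, ht, hκ]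

theorem signFactor_eq_neg_one_iff_of_unram (W W' : WeierstrassCurve ℚ) [W.IsGloballyMinimal] (q : ℕ) [Fact q.Prime]
    (ht : ¬ MonodromyBitAtTwo W' q) :
    levelRaisedSignFactor W W' q = -1 ↔ (W'.HasSplitMultiplicativeReductionAtPrime q ↔ ¬ RealTwistEven W W') := by
  unfold levelRaisedSignFactor
  by_cases hs : W'.HasSplitMultiplicativeReductionAtPrime q <;> by_cases hk : RealTwistEven W W' <;> simp [hs, ht, hk]

/-- ES-29A ⟹ ES-29U (pure sign algebra). -/
theorem unram_of_signLaw (h : LevelRaisedSignLawAtTwo) : LevelRaisedSignLawAtTwoUnram := by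
  intro W W' _ _ _ _ q _ h1 h2 h3 h4 h5 h6 hq hgood htr hlev hc hm ht
  have key := h W W' q h1 h2 h3 h4 h5 h6 hq hgood htr hlev hc hm
  rw [key]
  exact signFactor_eq_neg_one_iff_of_unram W W' q (fun h' => h' ht)

/-- ES-29A ⟹ ES-29N given that the archimedean twist is even when `Δ_W < 0` (hypothesis `hreal`, the one-real-root fact; kept as a
hypothesis so that this file proves only sign algebra). -/
theorem neg_of_signLaw (h : LevelRaisedSignLawAtTwo)
    (hreal : ∀ (W W' : WeierstrassCurve ℚ), ModTwoCongruent W W' → W.Δ < 0 → RealTwistEven W W') : LevelRaisedSignLawAtTwoNeg := by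
  intro W W' _ _ _ _ q _ h1 h2 h3 h4 h5 h6 hq hgood htr hlev hc hm hneg
  have key := h W W' q h1 h2 h3 h4 h5 h6 hq hgood htr hlev hc hm
  rw [key]
  exact signFactor_eq_neg_one_iff_of_realTwistEven W W' q (hreal W W' hc hneg)


/-- **ES-29M `LevelRaisedSignLawAtTwoMult` — the MULTIPLICATIVE-AT-2 case (`2 ∥ N_W`): THEOREM-candidate** (proved on paper, MEMO-es §29.1 (T6):
at a multiplicative `2` the dyadic symbol is `C₂ = [(s₂,−Δ_W)₂ = −1] + [(s₂, −Δ_W·f'_W(e_{T_μ}))₂ = −1]` and `f'_W(e_{T_μ}) ∈ ℚ₂ˣ²` on a Tate curve,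
so `C₂ = 0`; census `v₂N = 1`: 69 419 / 69 419).  No `NontrivialAtTwo` binder is needed (`v₂(Δ_W)` odd forces `ρ̄|_{G_{ℚ₂}} ≠ 1`).
Why it might still fail as typed: an ADDITIVE odd `p ∣ N_W` (local dictionary there unproved; census-clean) or a slip in the `q`/`∞` dictionary for
`w(W) = +1` bases (untested by census).  Same sources as ES-29A + [cite: SilvermanAdvanced, Thm. V.3.1, V.5.3 (Tate curve over ℚ_p incl. p = 2)]. -/
@[conjecture] def LevelRaisedSignLawAtTwoMult : Prop :=
  ∀ (W W' : WeierstrassCurve ℚ) [W.IsElliptic] [W.IsGloballyMinimal] [W'.IsElliptic] [W'.IsGloballyMinimal]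
    (q : ℕ) [Fact q.Prime],
    ¬ W.HasCM → (∀ n : ℕ, W.HasSurjectiveModNGaloisRep ((2 ^ n : ℕ) : ℤ)) → Odd W.torsionOrder → Odd W.tamagawaProduct →
    (2 : ℕ) ∣ W.conductorNorm ℤ → ¬ (4 : ℕ) ∣ W.conductorNorm ℤ →
    q ≠ 2 → ¬ (q : ℤ) ∣ (W.conductorNorm ℤ : ℤ) → jacobiSym W.Δ.num q = -1 → W'.conductorNorm ℤ = q * W.conductorNorm ℤ →
    ModTwoCongruent W W' → W'.HasMultiplicativeReductionAtPrime q →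
      ((Even W'.analyticRank ↔ Even W.analyticRank) ↔ levelRaisedSignFactor W W' q = -1)

/-- **ES-29G `LevelRaisedSignLawAtTwoGood` — the GOOD-AT-2 case (`2 ∤ N_W`, `ρ̄|_{G_{ℚ₂}} ≠ 1`): the genuinely CONJECTURAL part = a FLAT
RECIPROCITY AT 2** (MEMO-es §29.1 (ES-29♭)): for the components `(ψ = res χ_{d'}, ξ = β)` of the finite-flat mod-`4` difference cocycle,
`[(d', −Δ_W)₂ = −1] = Σ_{w ∣ 2} [(β, γ_W)_w = −1]`.  Census `v₂N = 0` frame: 21 748 / 21 748 (ordinary: both symbols occur and agree;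
supersingular: both vanish, SR29 pilot 318/318); FALSE without `NontrivialAtTwo` (`ρ̄|_{G_{ℚ₂}} = 1`: 226 / 1 523 rows with `C₂ = 1`).
Why it might fail: a good-ordinary `2`-adic class with `ℚ₂(√f'_W(e_°))` ramified (the formal-group lemma says unit part `≡ 1 (4)`, valuation `−4`)
or a supersingular class where `χ_{d'}` ramifies at `2`; `w(W) = +1` bases untested. -/
@[conjecture] def LevelRaisedSignLawAtTwoGood : Prop :=
  ∀ (W W' : WeierstrassCurve ℚ) [W.IsElliptic] [W.IsGloballyMinimal] [W'.IsElliptic] [W'.IsGloballyMinimal]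
    (q : ℕ) [Fact q.Prime],
    ¬ W.HasCM → (∀ n : ℕ, W.HasSurjectiveModNGaloisRep ((2 ^ n : ℕ) : ℤ)) → Odd W.torsionOrder → Odd W.tamagawaProduct →
    ¬ (2 : ℕ) ∣ W.conductorNorm ℤ → NontrivialAtTwo W →
    q ≠ 2 → ¬ (q : ℤ) ∣ (W.conductorNorm ℤ : ℤ) → jacobiSym W.Δ.num q = -1 → W'.conductorNorm ℤ = q * W.conductorNorm ℤ →
    ModTwoCongruent W W' → W'.HasMultiplicativeReductionAtPrime q →
      ((Even W'.analyticRank ↔ Even W.analyticRank) ↔ levelRaisedSignFactor W W' q = -1)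

/-- GLUE: ES-29A = ES-29G ∧ ES-29M (split on `2 ∣ N_W`). -/
theorem signLaw_of_good_of_mult (hg : LevelRaisedSignLawAtTwoGood) (hm : LevelRaisedSignLawAtTwoMult) : LevelRaisedSignLawAtTwo := by
  intro W W' _ _ _ _ q _ h1 h2 h3 h4 h5 h6 hq hgood htr hlev hc hmq
  by_cases h2N : (2 : ℕ) ∣ W.conductorNorm ℤ
  · exact hm W W' q h1 h2 h3 h4 h2N h5 hq hgood htr hlev hc hmq
  · exact hg W W' q h1 h2 h3 h4 h2N h6 hq hgood htr hlev hc hmq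

theorem good_of_signLaw (h : LevelRaisedSignLawAtTwo) : LevelRaisedSignLawAtTwoGood := by
  intro W W' _ _ _ _ q _ h1 h2 h3 h4 h2N h6 hq hgood htr hlev hc hmq
  have h4N : ¬ (4 : ℕ) ∣ W.conductorNorm ℤ := fun h4' => h2N (Nat.dvd_trans ⟨2, rfl⟩ h4')
  exact h W W' q h1 h2 h3 h4 h4N h6 hq hgood htr hlev hc hmq

theorem signLaw_iff_good_and_mult (hmult_nontriv : ∀ (W : WeierstrassCurve ℚ) [W.IsElliptic] [W.IsGloballyMinimal],
      Odd W.tamagawaProduct → (2 : ℕ) ∣ W.conductorNorm ℤ → ¬ (4 : ℕ) ∣ W.conductorNorm ℤ → NontrivialAtTwo W) :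
    LevelRaisedSignLawAtTwo ↔ (LevelRaisedSignLawAtTwoGood ∧ LevelRaisedSignLawAtTwoMult) := by
  constructor
  · intro h
    refine ⟨good_of_signLaw h, ?_⟩
    intro W W' _ _ _ _ q _ h1 h2 h3 h4 h2N h4N hq hgood htr hlev hc hmq
    exact h W W' q h1 h2 h3 h4 h4N (hmult_nontriv W h4 h2N h4N) hq hgood htr hlev hc hmq
  · rintro ⟨hg, hm⟩; exact signLaw_of_good_of_mult hg hm

end Summit.BirchSwinnertonDyer.BirchSwinnertonDyer.Theorems.RankOneAtTwoSignReciprocity
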